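import Summits.SmoothPoincare4.SmoothPoincare4.Theorems.SymplecticOrigamiGromovRecognitionRelEndEmbeddedLocalImage
import Literature.Geometry.Manifold.ProperSubmersionProduct
import Literature.Topology.FourManifolds.ImmersionCriterion
import Literature.Topology.FourManifolds.ImmersionOrientation
import Literature.Topology.FourManifolds.ProjectiveLineRotationField

/-!
# A product neighbourhood `ℂℙ¹ × ℂ` of an embedded sphere with trivial normal bundle
(registered helper `helper_productNbhd` of the stub `stub_normalWitnessTransfer`, line
`cross-cap-laurent`, crux `GromovRecognitionRelEnd`, item stmt-SmoothPoincare4-11009)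

Setting: an EMBEDDED two-chart sphere `S₀ = range u₀ ∪ {v₀ 0}` (`v₀ z = u₀ z⁻¹`) in a
`4`-manifold `X`, with glued map `F₀ : ℂℙ¹ → X`, cut out inside an open set `N` by a smooth
submersion `π : N → ℂ` (`{π = 0} ∩ N = S₀`).  Claim: there are an open `U` with `S₀ ⊆ U ⊆ N`, a
smooth submersion `g : U → ℂ` with zero set `S₀`, and a smooth embedding `ι : ℂℙ¹ × ℂ ↪ X` onto
`U` with `ι (θ, 0) = F₀ θ` and `g ∘ ι = pr₂` (the fibres `{g = t}` are the push-offs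
`ι (ℂℙ¹ × {t})` of `S₀`).

Proof (Ehresmann's fibration theorem for the proper submersion `π` near its compact fibre `S₀`,
Th. Bröcker, K. Jänich, *Introduction to Differential Topology* (1982), (8.12), in the form proved
in the tree as
`Literature.Geometry.Manifold.exists_isSmoothEmbedding_prod_euclidean_range_eq_of_surjective_mfderiv`):
`S₀ = F₀(ℂℙ¹)` is compact; choose an open `N₁ ⊇ S₀` with compact closure inside `N`; on the
compact `closure N₁ ∖ N₁` the map `π` does not vanish, so `π` avoids a disc `D = B(0, ρ₀)` there,
and `U = N₁ ∩ π⁻¹(D)` has `U ∩ π⁻¹(C) = closure N₁ ∩ π⁻¹(C)` compact for closed `C ⊆ D`.  With the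
ball-to-plane diffeomorphism `κ = univBall 0 ρ₀` put `g = κ⁻¹ ∘ π`: smooth, submersive and proper
on `U`, `{g = 0} ∩ U = S₀`.  The glued map `F₀` is a smooth embedding (smooth by the two-chart
lemmas, range `S₀` and injective by the landed `helper_gluedRange` /
`EmbeddedLocalImage.locImg_glued_injective`, injective differential; an injective immersion of
the compact `ℂℙ¹`, Hirsch (1976), Ch. 1 §3 Thm. 3.1), so the product theorem applied to the
`ℝ² ≅ ℂ`-valued `g` gives the embedding `ι`, transported back along `ℂ ≅ ℝ²`.
No new definitions.
-/

noncomputable section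

open scoped Manifold ContDiff Topology
open Set Function Metric Literature.Topology.FourManifolds
  Literature.Topology.FourManifolds.ComplexProjectiveSpace Literature.Geometry.Symplectic
  Literature.Topology.FourManifolds.CodimTwoData

-- the prescribed namespace `Summit.<P>.<Sub>.…` duplicates `SmoothPoincare4` (P = Sub)
set_option linter.dupNamespace false

namespace Summit.SmoothPoincare4.SmoothPoincare4.Theorems.GromovRecognitionRelEnd.CrossCapLaurent

namespace HelperProductNbhd

/-- The complex reading `Λ : ℝ² → ℂ`, `w ↦ (realCoordinates⁻¹ w)₀`, of the affine chart of `ℂℙ¹`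
is injective (`ℂ¹ = ℂ`). [folklore] -/
theorem injective_lam : Injective
    ((ContinuousLinearMap.proj (0 : Fin 1) : (Fin 1 → ℂ) →L[ℝ] ℂ).comp
      (realCoordinates 1).symm.toContinuousLinearMap) := by
  intro a b hab
  apply (realCoordinates 1).symm.injective
  funext j
  rw [Subsingleton.elim j 0]
  exact hab

/-- **The chart at infinity of an embedded two-chart sphere is an immersion**: if `u` is smooth
with injective differential, `v z = u z⁻¹` off `0` and `dv (0)` is injective, then `dv (w)` is
injective for every `w` (chain rule through the inversion, whose real differential at `w ≠ 0` is
multiplication by `-w⁻²`). [folklore] -/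
theorem injective_mfderiv_infty {X : Type*} [TopologicalSpace X]
    [ChartedSpace (EuclideanSpace ℝ (Fin 4)) X] [IsManifold (𝓡 4) ∞ X] {u v : ℂ → X}
    (hu : ContMDiff 𝓘(ℝ, ℂ) (𝓡 4) ∞ u) (hc : ∀ z : ℂ, z ≠ 0 → v z = u z⁻¹)
    (hdu : ∀ z, Injective (mfderiv 𝓘(ℝ, ℂ) (𝓡 4) u z))
    (hdv : Injective (mfderiv 𝓘(ℝ, ℂ) (𝓡 4) v 0)) (w : ℂ) :
    Injective (mfderiv 𝓘(ℝ, ℂ) (𝓡 4) v w) := by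
  by_cases hw : w = 0
  · rw [hw]; exact hdv
  have hu' : HasMFDerivAt 𝓘(ℝ, ℂ) (𝓡 4) u ((fun z : ℂ => z⁻¹) w)
      (mfderiv 𝓘(ℝ, ℂ) (𝓡 4) u w⁻¹) :=
    (hu.mdifferentiableAt (by simp)).hasMFDerivAt
  have hev : v =ᶠ[𝓝 w] (u ∘ fun z : ℂ => z⁻¹) := by
    filter_upwards [isOpen_ne.mem_nhds hw] with z hz
    exact hc z hz
  rw [((hu'.comp w (hasMFDerivAt_iff_hasFDerivAt.2
    (hasFDerivAt_inv_restrictScalars hw))).congr_of_eventuallyEq hev).mfderiv]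
  refine fun (a : ℂ) (b : ℂ) hab => ?_
  have hab' : mfderiv 𝓘(ℝ, ℂ) (𝓡 4) u w⁻¹
        ((ContinuousLinearMap.smulRight (1 : ℂ →L[ℂ] ℂ) (-(w ^ 2)⁻¹)).restrictScalars ℝ a) =
      mfderiv 𝓘(ℝ, ℂ) (𝓡 4) u w⁻¹
        ((ContinuousLinearMap.smulRight (1 : ℂ →L[ℂ] ℂ) (-(w ^ 2)⁻¹)).restrictScalars ℝ b) := hab
  have h2 : ((ContinuousLinearMap.smulRight (1 : ℂ →L[ℂ] ℂ) (-(w ^ 2)⁻¹)).restrictScalars ℝ a :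
      ℂ) = (ContinuousLinearMap.smulRight (1 : ℂ →L[ℂ] ℂ) (-(w ^ 2)⁻¹)).restrictScalars ℝ b :=
    hdu w⁻¹ hab'
  have hw2 : (-(w ^ 2)⁻¹ : ℂ) ≠ 0 := neg_ne_zero.mpr (inv_ne_zero (pow_ne_zero 2 hw))
  have h3 : @HMul.hMul ℂ ℂ ℂ instHMul a (-(w ^ 2)⁻¹) = @HMul.hMul ℂ ℂ ℂ instHMul b (-(w ^ 2)⁻¹) := by
    simpa only [ContinuousLinearMap.coe_restrictScalars', ContinuousLinearMap.smulRight_apply,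
      one_apply_eq_self, smul_eq_mul] using h2
  exact (mul_right_cancel₀ hw2 h3 : @Eq ℂ a b)

end HelperProductNbhd

open HelperProductNbhd in
/-- **Product neighbourhood of an embedded sphere with trivial normal bundle** (Ehresmann's
theorem for the proper submersion `π` near its compact fibre `S₀ = range u₀ ∪ {v₀ 0}`,
Bröcker–Jänich (1982), (8.12)): an open `U` with `S₀ ⊆ U ⊆ N`, a smooth submersion `g : U → ℂ`
with zero set `S₀`, and a smooth embedding `ι : ℂℙ¹ × ℂ ↪ X` onto `U` with `ι (θ, 0) = F₀ θ` and
`g ∘ ι = pr₂`. [cite: BrockerJanichIDT1982, (8.12) (PDF pp. 57–58)] -/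
theorem helper_productNbhd : ∀ (X : Type) [TopologicalSpace X] [T2Space X]
    [SecondCountableTopology X] [ChartedSpace (EuclideanSpace ℝ (Fin 4)) X]
    [IsManifold (𝓡 4) ∞ X] (u₀ v₀ : ℂ → X) (N : Set X) (π : X → ℂ)
    (F₀ : C(Literature.Topology.FourManifolds.ComplexProjectiveSpace 1, X)),
    ContMDiff 𝓘(ℝ, ℂ) (𝓡 4) ∞ u₀ → ContMDiff 𝓘(ℝ, ℂ) (𝓡 4) ∞ v₀ →
    (∀ z : ℂ, z ≠ 0 → v₀ z = u₀ z⁻¹) → Function.Injective u₀ →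
    (∀ z, Function.Injective (mfderiv 𝓘(ℝ, ℂ) (𝓡 4) u₀ z)) →
    Function.Injective (mfderiv 𝓘(ℝ, ℂ) (𝓡 4) v₀ 0) → v₀ 0 ∉ Set.range u₀ → IsOpen N →
    Set.range u₀ ∪ {v₀ 0} ⊆ N → ContMDiffOn (𝓡 4) 𝓘(ℝ, ℂ) ∞ π N →
    (∀ y ∈ N, Function.Surjective (mfderiv (𝓡 4) 𝓘(ℝ, ℂ) π y)) →
    {y | y ∈ N ∧ π y = 0} = Set.range u₀ ∪ {v₀ 0} →
    (∀ p, Literature.Topology.FourManifolds.ComplexProjectiveSpace.CoordNeZero 0 p →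
      F₀ p = u₀ (Literature.Topology.FourManifolds.ComplexProjectiveSpace.affineCoordComplex 0 p 0)) →
    (∀ p, Literature.Topology.FourManifolds.ComplexProjectiveSpace.CoordNeZero 1 p →
      F₀ p = v₀ (Literature.Topology.FourManifolds.ComplexProjectiveSpace.affineCoordComplex 1 p 0)) →
    ∃ (U : Set X) (g : X → ℂ) (ι : Literature.Topology.FourManifolds.ComplexProjectiveSpace 1 × ℂ → X),
    IsOpen U ∧ Set.range u₀ ∪ {v₀ 0} ⊆ U ∧ U ⊆ N ∧ ContMDiffOn (𝓡 4) 𝓘(ℝ, ℂ) ∞ g U ∧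
    (∀ y ∈ U, Function.Surjective (mfderiv (𝓡 4) 𝓘(ℝ, ℂ) g y)) ∧
    {y | y ∈ U ∧ g y = 0} = Set.range u₀ ∪ {v₀ 0} ∧
    Manifold.IsSmoothEmbedding ((𝓡 2).prod 𝓘(ℝ, ℂ)) (𝓡 4) ∞ ι ∧
    ContMDiff ((𝓡 2).prod 𝓘(ℝ, ℂ)) (𝓡 4) ∞ ι ∧ Function.Injective ι ∧
    (∀ q, Function.Injective (mfderiv ((𝓡 2).prod 𝓘(ℝ, ℂ)) (𝓡 4) ι q)) ∧ Set.range ι = U ∧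
    (∀ θ, ι (θ, 0) = F₀ θ) ∧ (∀ q, g (ι q) = q.2) := by
  intro X _ _ _ _ _ u₀ v₀ N π F₀ hu0 hv0 hc hinj hdu hdv hinf hN hSN hπ hdπ hzero hF0 hF1
  -- the sphere `S₀ = F₀(ℂℙ¹)` is compact and `π` vanishes on it
  set S₀ : Set X := range u₀ ∪ {v₀ 0}
  have hrange : range F₀ = S₀ := helper_gluedRange X u₀ v₀ F₀ hc hF0 hF1
  have hSc : IsCompact S₀ := hrange ▸ isCompact_range F₀.continuous
  have hπS : ∀ y ∈ S₀, π y = 0 := fun y hy => by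
    have h : y ∈ {y | y ∈ N ∧ π y = 0} := by rw [hzero]; exact hy
    exact h.2
  -- a relatively compact open `N₁`, `S₀ ⊆ N₁ ⊆ closure N₁ ⊆ N`
  haveI : LocallyCompactSpace X := Manifold.locallyCompact_of_finiteDimensional (M := X) (𝓡 4)
  obtain ⟨N₁, hN₁o, hSN₁, hclN, hclc⟩ := exists_open_between_and_isCompact_closure hSc hN hSN
  have hN₁N : N₁ ⊆ N := subset_closure.trans hclN
  have hπc : ContinuousOn π (closure N₁) := hπ.continuousOn.mono hclN
  -- `π` avoids a disc `B(0, ρ₀)` on the compact frontier `closure N₁ \ N₁`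
  have hKc : IsCompact (π '' (closure N₁ \ N₁)) :=
    (hclc.diff hN₁o).image_of_continuousOn (hπc.mono fun _ hx => hx.1)
  have h0K : (0 : ℂ) ∉ π '' (closure N₁ \ N₁) := by
    rintro ⟨y, ⟨hycl, hyN₁⟩, hy0⟩
    have hyS : y ∈ S₀ := by rw [← hzero]; exact ⟨hclN hycl, hy0⟩
    exact hyN₁ (hSN₁ hyS)
  obtain ⟨ρ₀, hρ₀, hball⟩ : ∃ ρ₀ > 0, ball (0 : ℂ) ρ₀ ⊆ (π '' (closure N₁ \ N₁))ᶜ :=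
    Metric.isOpen_iff.1 hKc.isClosed.isOpen_compl 0 h0K
  -- the neighbourhood `U = N₁ ∩ π⁻¹(B(0, ρ₀))`
  obtain ⟨U, hU⟩ : ∃ U : Set X, U = N₁ ∩ π ⁻¹' ball (0 : ℂ) ρ₀ := ⟨_, rfl⟩
  have hUo : IsOpen U := by
    rw [hU]; exact (hπ.continuousOn.mono hN₁N).isOpen_inter_preimage hN₁o isOpen_ball
  have hUN₁ : U ⊆ N₁ := by rw [hU]; exact inter_subset_left
  have hUN : U ⊆ N := hUN₁.trans hN₁N
  have hπU : ∀ y ∈ U, π y ∈ ball (0 : ℂ) ρ₀ := fun y hy => by rw [hU] at hy; exact hy.2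
  have hSU : S₀ ⊆ U := fun y hy => by
    rw [hU]; exact ⟨hSN₁ hy, show π y ∈ ball (0 : ℂ) ρ₀ by rw [hπS y hy]; exact mem_ball_self hρ₀⟩
  -- `U ∩ π⁻¹(C)` is compact for every closed `C` inside the disc
  have hkey : ∀ C ⊆ ball (0 : ℂ) ρ₀, IsClosed C → IsCompact (U ∩ π ⁻¹' C) := by
    intro C hC hCc
    have heq : U ∩ π ⁻¹' C = closure N₁ ∩ π ⁻¹' C := by
      ext y
      constructor
      · rintro ⟨hyU, hyC⟩
        exact ⟨subset_closure (hUN₁ hyU), hyC⟩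
      · rintro ⟨hycl, hyC⟩
        have hyN₁ : y ∈ N₁ := by
          by_contra h
          exact hball (hC hyC) ⟨y, ⟨hycl, h⟩, rfl⟩
        have hyU : y ∈ U := by rw [hU]; exact ⟨hyN₁, hC hyC⟩
        exact ⟨hyU, hyC⟩
    rw [heq]
    exact hclc.of_isClosed_subset (hπc.preimage_isClosed_of_isClosed isClosed_closure hCc)
      inter_subset_left
  -- the ball-to-plane diffeomorphism `κ` and the submersion `g = κ⁻¹ ∘ π`
  set ub := OpenPartialHomeomorph.univBall (0 : ℂ) ρ₀
  have hubt : ub.target = ball (0 : ℂ) ρ₀ := OpenPartialHomeomorph.univBall_target 0 hρ₀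
  have hubs : ub.source = univ := OpenPartialHomeomorph.univBall_source 0 ρ₀
  have hub0 : ub 0 = 0 := OpenPartialHomeomorph.univBall_apply_zero 0 ρ₀
  have hubsm : ContMDiff 𝓘(ℝ, ℂ) 𝓘(ℝ, ℂ) ∞ ub :=
    (OpenPartialHomeomorph.contDiff_univBall (c := (0 : ℂ)) (r := ρ₀)).contMDiff
  have hubsymm : ContMDiffOn 𝓘(ℝ, ℂ) 𝓘(ℝ, ℂ) ∞ ub.symm (ball (0 : ℂ) ρ₀) :=
    (OpenPartialHomeomorph.contDiffOn_univBall_symm (c := (0 : ℂ)) (r := ρ₀)).contMDiffOn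
  have hleft : ∀ z, ub.symm (ub z) = z := fun z => ub.left_inv (by rw [hubs]; exact mem_univ z)
  have hright : ∀ w ∈ ball (0 : ℂ) ρ₀, ub (ub.symm w) = w := fun w hw =>
    ub.right_inv (by rw [hubt]; exact hw)
  have hubmem : ∀ z, ub z ∈ ball (0 : ℂ) ρ₀ := fun z => by
    rw [← hubt]; exact ub.map_source (by rw [hubs]; exact mem_univ z)
  -- `d(κ⁻¹)` is onto on the disc
  have hdsymm : ∀ w ∈ ball (0 : ℂ) ρ₀, Surjective (mfderiv 𝓘(ℝ, ℂ) 𝓘(ℝ, ℂ) ub.symm w) := by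
    intro w hw
    have h1 : MDifferentiableAt 𝓘(ℝ, ℂ) 𝓘(ℝ, ℂ) ub.symm (ub (ub.symm w)) := by
      rw [hright w hw]
      exact (hubsymm.contMDiffAt (isOpen_ball.mem_nhds hw)).mdifferentiableAt (by simp)
    have h2 : MDifferentiableAt 𝓘(ℝ, ℂ) 𝓘(ℝ, ℂ) ub (ub.symm w) :=
      (hubsm _).mdifferentiableAt (by simp)
    have hcomp := mfderiv_comp (ub.symm w) h1 h2
    rw [show ((ub.symm : ℂ → ℂ) ∘ (ub : ℂ → ℂ)) = id from funext hleft, mfderiv_id,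
      hright w hw] at hcomp
    intro v
    refine ⟨mfderiv 𝓘(ℝ, ℂ) 𝓘(ℝ, ℂ) ub (ub.symm w) v, ?_⟩
    exact (ContinuousLinearMap.ext_iff.1 hcomp v).symm
  set g : X → ℂ := fun y => ub.symm (π y)
  have hgs : ContMDiffOn (𝓡 4) 𝓘(ℝ, ℂ) ∞ g U :=
    hubsymm.comp (hπ.mono hUN) fun y hy => hπU y hy
  have hdg : ∀ y ∈ U, Surjective (mfderiv (𝓡 4) 𝓘(ℝ, ℂ) g y) := by
    intro y hy
    have hπd : MDifferentiableAt (𝓡 4) 𝓘(ℝ, ℂ) π y :=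
      (hπ.contMDiffAt (hN.mem_nhds (hUN hy))).mdifferentiableAt (by simp)
    have hsd : MDifferentiableAt 𝓘(ℝ, ℂ) 𝓘(ℝ, ℂ) ub.symm (π y) :=
      (hubsymm.contMDiffAt (isOpen_ball.mem_nhds (hπU y hy))).mdifferentiableAt (by simp)
    have hd' : mfderiv (𝓡 4) 𝓘(ℝ, ℂ) g y = _ := (hsd.hasMFDerivAt.comp y hπd.hasMFDerivAt).mfderiv
    rw [hd']
    exact (hdsymm _ (hπU y hy)).comp (hdπ y (hUN hy))
  have hg0 : ∀ y ∈ U, g y = 0 ↔ π y = 0 := by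
    intro y hy
    constructor
    · intro h
      have h' := hright (π y) (hπU y hy)
      rw [show ub.symm (π y) = 0 from h, hub0] at h'
      exact h'.symm
    · intro h
      show ub.symm (π y) = 0
      rw [h]
      exact OpenPartialHomeomorph.univBall_symm_apply_center 0 ρ₀
  have hgzero : {y | y ∈ U ∧ g y = 0} = S₀ := by
    ext y
    constructor
    · rintro ⟨hyU, hgy⟩
      rw [← hzero]
      exact ⟨hUN hyU, (hg0 y hyU).1 hgy⟩
    · intro hy
      exact ⟨hSU hy, (hg0 y (hSU hy)).2 (hπS y hy)⟩
  -- the glued map `F₀` is a smooth embedding of `ℂℙ¹`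
  set uv : Fin 2 → ℂ → X := ![u₀, v₀]
  have huv : ∀ i, ContMDiff 𝓘(ℝ, ℂ) (𝓡 4) ∞ (uv i) := Fin.forall_fin_two.2 ⟨hu0, hv0⟩
  have hFuv : ∀ i p, CoordNeZero i p → F₀ p = uv i (affineCoordComplex i p 0) :=
    Fin.forall_fin_two.2 ⟨hF0, hF1⟩
  have hduv : ∀ i z, Injective (mfderiv 𝓘(ℝ, ℂ) (𝓡 4) (uv i) z) :=
    Fin.forall_fin_two.2 ⟨hdu, injective_mfderiv_infty hu0 hc hdu hdv⟩
  have hFs : ContMDiff (𝓡 2) (𝓡 4) ∞ F₀ := contMDiff_glued huv hFuv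
  have hFd : ∀ x, Injective (mfderiv (𝓡 2) (𝓡 4) F₀ x) := fun x => by
    have h' : mfderiv (𝓡 2) (𝓡 4) F₀ x = _ :=
      (hasMFDerivAt_glued x (hFuv (chartIndex x)) (((huv _) _).mdifferentiableAt (by simp))).mfderiv
    rw [h']
    exact (hduv _ _).comp injective_lam
  have hFemb : Manifold.IsSmoothEmbedding (𝓡 2) (𝓡 4) ∞ F₀ :=
    isSmoothEmbedding_of_injective_of_injective_mfderiv hFs (by exact_mod_cast le_top)
      (EmbeddedLocalImage.locImg_glued_injective hF0 hF1 hinj hinf) hFd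
  -- `ℂ ≅ ℝ²`, and `g` read in `ℝ²`
  set Lc : ℂ ≃L[ℝ] EuclideanSpace ℝ (Fin 2) :=
    Complex.orthonormalBasisOneI.repr.toContinuousLinearEquiv
  have hdim : Module.finrank ℝ (EuclideanSpace ℝ (Fin 2) × EuclideanSpace ℝ (Fin 2)) =
      Module.finrank ℝ (EuclideanSpace ℝ (Fin 4)) := by simp
  set g' : X → EuclideanSpace ℝ (Fin 2) := fun y => Lc (g y)
  have hg's : ContMDiffOn (𝓡 4) 𝓘(ℝ, EuclideanSpace ℝ (Fin 2)) ∞ g' U :=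
    Lc.contDiff.contMDiff.comp_contMDiffOn hgs
  have hdg' : ∀ y ∈ U, Surjective (mfderiv (𝓡 4) 𝓘(ℝ, EuclideanSpace ℝ (Fin 2)) g' y) := by
    intro y hy
    have hgd : MDifferentiableAt (𝓡 4) 𝓘(ℝ, ℂ) g y :=
      (hgs.contMDiffAt (hUo.mem_nhds hy)).mdifferentiableAt (by simp)
    have hd' : mfderiv (𝓡 4) 𝓘(ℝ, EuclideanSpace ℝ (Fin 2)) g' y = _ :=
      (Lc.hasMFDerivAt.comp y hgd.hasMFDerivAt).mfderiv
    rw [hd']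
    exact Lc.surjective.comp (hdg y hy)
  have hK' : ∀ (c : EuclideanSpace ℝ (Fin 2)) (R : ℝ), IsCompact (U ∩ g' ⁻¹' closedBall c R) := by
    intro c R
    set K : Set ℂ := ub '' (Lc.symm '' closedBall c R) with hK
    have hKc : IsCompact K :=
      ((isCompact_closedBall c R).image Lc.symm.continuous).image hubsm.continuous
    have hKsub : K ⊆ ball (0 : ℂ) ρ₀ := by
      rintro _ ⟨z, -, rfl⟩; exact hubmem z
    have heq : U ∩ g' ⁻¹' closedBall c R = U ∩ π ⁻¹' K := by
      ext y
      constructor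
      · rintro ⟨hyU, hyK⟩
        refine ⟨hyU, ?_⟩
        rw [mem_preimage, ← hright (π y) (hπU y hyU)]
        exact mem_image_of_mem ub ⟨g' y, hyK, Lc.symm_apply_apply (g y)⟩
      · rintro ⟨hyU, hyK⟩
        rw [mem_preimage, hK] at hyK
        obtain ⟨z, ⟨e, he, rfl⟩, hzy⟩ := hyK
        refine ⟨hyU, ?_⟩
        have hge : g' y = e := by
          show Lc (ub.symm (π y)) = e
          rw [← hzy, hleft, Lc.apply_symm_apply]
        rw [mem_preimage, hge]
        exact he
    rw [heq]
    exact hkey K hKsub hKc.isClosed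
  have hσg : range F₀ = U ∩ g' ⁻¹' {0} := by
    rw [hrange, ← hgzero]
    ext y
    constructor
    · rintro ⟨hyU, h⟩
      exact ⟨hyU, show Lc (g y) = 0 by rw [h, map_zero]⟩
    · rintro ⟨hyU, h⟩
      exact ⟨hyU, (map_eq_zero_iff Lc Lc.injective).1 h⟩
  -- Ehresmann: `U ≅ ℂℙ¹ × ℝ²` over `g'`
  obtain ⟨ι', hι'emb, hι'range, hι'0, hι'g⟩ :=
    Literature.Geometry.Manifold.exists_isSmoothEmbedding_prod_euclidean_range_eq_of_surjective_mfderiv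
      (I := 𝓡 4) (IF := 𝓡 2) (⟨U, hUo⟩ : TopologicalSpace.Opens X) hg's hdg' hK' hFemb
      (ContinuousLinearEquiv.ofFinrankEq hdim) hσg
  -- transport back along `ℂ ≅ ℝ²`
  let P : Diffeomorph ((𝓡 2).prod 𝓘(ℝ, ℂ)) ((𝓡 2).prod 𝓘(ℝ, EuclideanSpace ℝ (Fin 2)))
      (ComplexProjectiveSpace 1 × ℂ) (ComplexProjectiveSpace 1 × EuclideanSpace ℝ (Fin 2)) ∞ :=
    { toEquiv := (Equiv.refl _).prodCongr Lc.toLinearEquiv.toEquiv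
      contMDiff_toFun := contMDiff_fst.prodMk (Lc.contDiff.contMDiff.comp contMDiff_snd)
      contMDiff_invFun :=
        contMDiff_fst.prodMk (Lc.symm.contDiff.contMDiff.comp contMDiff_snd) }
  have hPapply : ∀ θ z, P (θ, z) = (θ, Lc z) := fun θ z => rfl
  have hPd : ∀ q, Injective
      (mfderiv ((𝓡 2).prod 𝓘(ℝ, ℂ)) ((𝓡 2).prod 𝓘(ℝ, EuclideanSpace ℝ (Fin 2))) P q) :=
    fun q => by
    have h := (P.mfderivToContinuousLinearEquiv (by simp) q).injective
    rwa [← ContinuousLinearEquiv.coe_coe, Diffeomorph.mfderivToContinuousLinearEquiv_coe] at h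
  set ι : ComplexProjectiveSpace 1 × ℂ → X := ι' ∘ P with hι
  have hιs : ContMDiff ((𝓡 2).prod 𝓘(ℝ, ℂ)) (𝓡 4) ∞ ι := hι'emb.contMDiff.comp P.contMDiff
  have hιinj : Injective ι := hι'emb.isEmbedding.injective.comp (EquivLike.injective P)
  have hιd : ∀ q, Injective (mfderiv ((𝓡 2).prod 𝓘(ℝ, ℂ)) (𝓡 4) ι q) := fun q => by
    have hd' : mfderiv ((𝓡 2).prod 𝓘(ℝ, ℂ)) (𝓡 4) ι q = _ :=
      (((hι'emb.contMDiff (P q)).mdifferentiableAt (by simp)).hasMFDerivAt.comp q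
        ((P.mdifferentiable (by simp)) q).hasMFDerivAt).mfderiv
    rw [hd']
    exact (injective_mfderiv_of_isImmersionAt' (hι'emb.isImmersion.isImmersionAt _)).comp (hPd q)
  have hιemb : Manifold.IsSmoothEmbedding ((𝓡 2).prod 𝓘(ℝ, ℂ)) (𝓡 4) ∞ ι :=
    ⟨isImmersion_of_injective_mfderiv hιs (by exact_mod_cast le_top) hιd,
      hι'emb.isEmbedding.comp P.toHomeomorph.isEmbedding⟩
  have hιrange : range ι = U := by
    rw [hι, (EquivLike.surjective P).range_comp]; exact hι'range
  have hι0 : ∀ θ, ι (θ, 0) = F₀ θ := fun θ => by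
    show ι' (P (θ, 0)) = F₀ θ
    rw [hPapply, map_zero]
    exact hι'0 θ
  have hιg : ∀ q, g (ι q) = q.2 := by
    rintro ⟨θ, z⟩
    have h := hι'g (P (θ, z))
    rw [hPapply, zero_add] at h
    exact Lc.injective h
  exact ⟨U, g, ι, hUo, hSU, hUN, hgs, hdg, hgzero, hιemb, hιs, hιinj, hιd, hιrange, hι0, hιg⟩

end Summit.SmoothPoincare4.SmoothPoincare4.Theorems.GromovRecognitionRelEnd.CrossCapLaurent
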